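import Summits.QuantumAdvantage.QuantumAdvantage.Theorems.CubicForrelationNearExactIsExactTwelveTypeO943

/-!
# Crux `CubicForrelation.NearExactIsExact` (stmt-QuantumAdvantage-14043) — no cubic Boolean function on 12 bits has weight in `(768, 816]`
  (the Kasami–Tokura gap values `784, 800, 816`, by Fourier moments)

Certificate seat `b2b-cforr-cert` (gen 15).  HONEST FRAMING: a coding-theory lemma (standard axioms) about cubic Boolean functions on 12 bits —
the brick for the TYPE-O branch at the values `941/1024, 942/1024` of `θ₁₂` (there the base set `E` of a type-O side has `4096 + 8·#E ≤ 10624`,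
`#E > 768`, `16 ∣ #E`, i.e. `#E ∈ {784, 800, 816}`).  By Kasami–Tokura (1970) no weight of `RM(3,12)` lies strictly between `768` and `896`; that
classification is not in the tree, and the three values are excluded here by the self-contained moment argument of `to15_weight784_none`
run with a symbolic weight (the squeeze closes for `w ≤ 816` and fails from `832` on).  Finite-slice bookkeeping, NOT summit progress.

`to15_weight_gap_none`.  With `E = {c = 1}`, `w = #E ∈ (768, 816]`, `F(z) = Σ_E (−1)^{x·z}`, `I(a) = #(E ∩ (E ⊕ a))`:
half weights `#(E ∩ H) ∈ {0, 256, w − 256, w} ∪ [384, w − 384]` (`to15_halfweight_gap`); `I(a) ∈ {w − 768, w − 512, w}` (`to15_deriv_values`),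
so `E` lies in no affine hyperplane and `|F| ≤ w − 512` off `0`; `16 ∣ w` (`to15_weight_gap16`); Parseval, the fourth moment
`Σ F⁴ = 2¹² Σ_a I(a)²`, `Σ_a I(a) = w²`, and the chord bound `I² ≥ (2w − 1280)I − (w − 768)(w − 512)` give
`2¹²((2w − 1280)w² − 2¹²(w − 768)(w − 512)) ≤ Σ F⁴ ≤ (w − 512)²·2¹²·w + w⁴ − (w − 512)²w²`, false for `w ∈ {784, 800, 816}`.

References: T. Kasami, N. Tokura, IEEE Trans. IT 16 (1970) 752–759; MacWilliams–Sloane (1977) Ch. 15 §3; R. O'Donnell (2014) §3.3.  Axioms: standard.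
-/

set_option linter.dupNamespace false -- D-0017: single-problem summit ⇒ `QuantumAdvantage.QuantumAdvantage` by design

noncomputable section

namespace Summit.QuantumAdvantage.QuantumAdvantage.Theorems.CubicForrelation.NearExactIsExact

open Finset
open Literature.Computability.QuantumComplexity
open Literature.Computability.QuantumComplexity.BuzetChailloux (bxor zeroVec bxor_bxor_cancel_left bxor_zeroVec zeroVec_bxor bxor_comm
  bxor_self twist_zeroVec_right twist_bxor_right)
open Literature.Computability.QuantumComplexity.DerivativeWalsh (W twist_bxor_left)
open Literature.Computability.QuantumComplexity.Simon (twist_eq_one_or)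
open Summit.QuantumAdvantage.QuantumAdvantage.Theorems.SignedCubicForrelationNotPrBPP (knf_isDegLeFun_ip)

/-! ### Half weights of a heavy cubic -/

/-- **Half weights of a cubic of weight `w ≥ 768` on 12 bits.**  If `c` is cubic with `#{c = 1} = w` and `ℓ` is affine, then
`#{c = 1, ℓ = 1} ∈ {0, 256, w − 256, w} ∪ [384, w − 384]` (second weight of `RM(4,12)` for `c·ℓ` and `c·(ℓ ⊕ 1)`). [this work] -/
theorem to15_halfweight_gap (c ℓ : (Fin (6 + 6) → Bool) → Bool) (hc : IsDegLeFun 3 c) (hℓ : IsDegLeFun 1 ℓ) :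
    #(univ.filter fun x => (c x && ℓ x) = true) = 0 ∨ #(univ.filter fun x => (c x && ℓ x) = true) = 256 ∨
    #(univ.filter fun x => (c x && ℓ x) = true) + 256 = #(univ.filter fun x => c x = true) ∨
    #(univ.filter fun x => (c x && ℓ x) = true) = #(univ.filter fun x => c x = true) ∨
    (384 ≤ #(univ.filter fun x => (c x && ℓ x) = true) ∧
      #(univ.filter fun x => (c x && ℓ x) = true) + 384 ≤ #(univ.filter fun x => c x = true)) := by
  classical
  set A := univ.filter (fun x : Fin (6 + 6) → Bool => (c x && ℓ x) = true) with hAdef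
  set B := univ.filter (fun x : Fin (6 + 6) → Bool => (c x && (ℓ x ^^ true)) = true) with hBdef
  have hAB : #A + #B = #(univ.filter fun x => c x = true) := by
    have eA : A = (univ.filter fun x : Fin (6 + 6) → Bool => c x = true).filter (fun x => ℓ x = true) := by
      ext x; simp only [hAdef, mem_filter, mem_univ, true_and]; cases c x <;> cases ℓ x <;> simp
    have eB : B = (univ.filter fun x : Fin (6 + 6) → Bool => c x = true).filter (fun x => ¬ ℓ x = true) := by
      ext x; simp only [hBdef, mem_filter, mem_univ, true_and]; cases c x <;> cases ℓ x <;> simp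
    rw [eA, eB, card_filter_add_card_filter_not]
  have hdegA : IsDegLeFun (3 + 1) (fun x => c x && ℓ x) := te_isDegLeFun_band hc hℓ
  have hdegB : IsDegLeFun (3 + 1) (fun x => c x && (ℓ x ^^ true)) := te_isDegLeFun_band hc (tb_isDegLeFun_xor_const hℓ true)
  have hsmall : ∀ (e : (Fin (6 + 6) → Bool) → Bool), IsDegLeFun (3 + 1) e → #(univ.filter fun x => e x = true) < 384 →
      #(univ.filter fun x => e x = true) = 0 ∨ #(univ.filter fun x => e x = true) = 256 := by
    intro e he hlt
    by_cases hne : ∃ x, e x = true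
    · right
      have h := sw_second_weight_all 4 (by norm_num) (6 + 6) e he hne (by norm_num; omega)
      norm_num at h
      omega
    · left
      push Not at hne
      exact card_eq_zero.2 (filter_eq_empty_iff.2 fun x _ => by simp [hne x])
  have hA := hsmall _ hdegA
  have hB := hsmall _ hdegB
  change #A < 384 → #A = 0 ∨ #A = 256 at hA
  change #B < 384 → #B = 0 ∨ #B = 256 at hB
  show #A = 0 ∨ #A = 256 ∨ #A + 256 = #(univ.filter fun x => c x = true) ∨ #A = #(univ.filter fun x => c x = true) ∨
    (384 ≤ #A ∧ #A + 384 ≤ #(univ.filter fun x => c x = true))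
  omega

/-! ### The theorem -/

/-- **No cubic Boolean function on 12 bits has `768 < #{c = 1} ≤ 816`** (`784, 800, 816` are gaps of the Kasami–Tokura list of `RM(3,12)`
weights; proved by Fourier moments with a symbolic weight).  Finite-slice statement; NOT summit progress. [this work] -/
theorem to15_weight_gap_none (c : (Fin (6 + 6) → Bool) → Bool) (hc : IsDegLeFun 3 c)
    (h1 : 768 < #(univ.filter fun x => c x = true)) (h2 : #(univ.filter fun x => c x = true) ≤ 816) : False := by
  classical
  have h16 := to15_weight_gap16 c hc h1 (by omega)
  have hIv := to15_deriv_values c hc h1 (by omega)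
  set S := univ.filter (fun x : Fin (6 + 6) → Bool => c x = true) with hSdef
  have hmemS : ∀ x, x ∈ S ↔ c x = true := fun x => by simp [hSdef]
  have hS1 : (768 : ℝ) < #S := by exact_mod_cast h1
  have hS2 : (#S : ℝ) ≤ 816 := by exact_mod_cast h2
  set F : (Fin (6 + 6) → Bool) → ℝ := fun z => ∑ x ∈ S, twist x z with hFdef
  /- (A) the values of `F`: `#S − 2k`, `k` a half weight -/
  have hFval : ∀ z, ∃ k : ℕ, (k = 0 ∨ k = 256 ∨ k + 256 = #S ∨ k = #S ∨ (384 ≤ k ∧ k + 384 ≤ #S)) ∧ F z = #S - 2 * (k : ℝ) := by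
    intro z
    set ℓ : (Fin (6 + 6) → Bool) → Bool := fun x => decide (Odd #(univ.filter fun i => x i && z i)) with hℓdef
    have hℓ : IsDegLeFun 1 ℓ := knf_isDegLeFun_ip z
    have htw : ∀ x, twist x z = 1 - 2 * (if ℓ x = true then (1 : ℝ) else 0) := by
      intro x
      rw [vg_twist_eq_signOf x z]
      change signOf (ℓ x) = 1 - 2 * (if ℓ x = true then (1 : ℝ) else 0)
      unfold signOf
      cases ℓ x <;> norm_num
    have hsum : F z = #S - 2 * (#(univ.filter fun x => (c x && ℓ x) = true) : ℝ) := by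
      simp only [F]
      rw [sum_congr rfl fun x _ => htw x, sum_sub_distrib, sum_const, ← mul_sum, sum_boole]
      have e : S.filter (fun x => ℓ x = true) = univ.filter fun x => (c x && ℓ x) = true := by
        ext x; simp only [hSdef, mem_filter, mem_univ, true_and]; cases c x <;> cases ℓ x <;> simp
      rw [e]; norm_num
    exact ⟨_, to15_halfweight_gap c ℓ hc hℓ, hsum⟩
  have hF0 : F zeroVec = #S := by
    simp only [F]
    rw [sum_congr rfl fun x _ => twist_zeroVec_right x, sum_const]; norm_num
  /- (C) Parseval `Σ F² = 2¹²·#S` -/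
  set A : (Fin (6 + 6) → Bool) → ℝ := fun x => if x ∈ S then 1 else 0 with hAdef
  have hWA : ∀ z, W A z = F z := by
    intro z
    unfold W
    have e : ∀ x, A x * twist x z = if x ∈ S then twist x z else 0 := fun x => by
      simp only [A]; split_ifs <;> simp
    rw [sum_congr rfl fun x _ => e x, ← sum_filter, filter_mem_eq_inter, univ_inter]
  have hPars : ∑ z, F z ^ 2 = 4096 * #S := by
    have h := fp_parseval_pm A S (fun x hx => Or.inl (by simp [A, hx])) (fun x hx => by simp [A, hx])
    rw [sum_congr rfl fun z _ => by rw [hWA z]] at h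
    rw [h]; norm_num
  /- (B) `I(a) ∈ {#S − 768, #S − 512, #S}` (real form) -/
  set I : (Fin (6 + 6) → Bool) → ℕ := fun a => #(S.filter fun x => bxor x a ∈ S) with hIdef
  have hIvalR : ∀ a, (I a : ℝ) = #S - 768 ∨ (I a : ℝ) = #S - 512 ∨ (I a : ℝ) = #S := by
    intro a
    rcases hIv a with h | h | h
    · left
      have h' : I a = #S - 768 := h
      rw [h']; push_cast [show 768 ≤ #S by omega]; ring
    · right; left
      have h' : I a = #S - 512 := h
      rw [h']; push_cast [show 512 ≤ #S by omega]; ring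
    · right; right
      have h' : I a = #S := h
      rw [h']
  /- (N) `E` lies in no affine hyperplane: `F(z) ≠ ±#S` for `z ≠ 0` -/
  have htw1 : ∀ x z : Fin (6 + 6) → Bool, twist x z ≤ 1 := fun x z => by
    rcases twist_eq_one_or x z with h | h <;> linarith
  have htw1' : ∀ x z : Fin (6 + 6) → Bool, -1 ≤ twist x z := fun x z => by
    rcases twist_eq_one_or x z with h | h <;> linarith
  have hI0_of : ∀ (z a : Fin (6 + 6) → Bool) (t : ℝ), (t = 1 ∨ t = -1) → twist a z = -1 → (∀ x ∈ S, twist x z = t) → I a = 0 := by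
    intro z a t ht ha hall
    simp only [I]
    refine card_eq_zero.2 (filter_eq_empty_iff.2 fun x hx hxa => ?_)
    have h1 := hall _ hxa
    rw [twist_bxor_left, hall x hx, ha] at h1
    rcases ht with rfl | rfl <;> norm_num at h1
  have hnoH : ∀ z, z ≠ zeroVec → F z ≠ #S ∧ F z ≠ -#S := by
    intro z hz0
    obtain ⟨a, ha⟩ := es_exists_twist_neg hz0
    rw [twist_comm] at ha
    have hIa : I a ≠ 0 := by
      intro h0
      have h0' : (I a : ℝ) = 0 := by exact_mod_cast h0
      rcases hIvalR a with h | h | h <;> linarith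
    constructor
    · intro hF
      refine hIa (hI0_of z a 1 (Or.inl rfl) ha fun x hx => ?_)
      have hsum0 : ∑ y ∈ S, (1 - twist y z) = 0 := by
        rw [sum_sub_distrib, sum_const, nsmul_eq_mul, mul_one]
        change (#S : ℝ) - F z = 0
        rw [hF]; ring
      have h := (sum_eq_zero_iff_of_nonneg fun y _ => by linarith [htw1 y z]).1 hsum0 x hx
      linarith
    · intro hF
      refine hIa (hI0_of z a (-1) (Or.inr rfl) ha fun x hx => ?_)
      have hsum0 : ∑ y ∈ S, (1 + twist y z) = 0 := by
        rw [sum_add_distrib, sum_const, nsmul_eq_mul, mul_one]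
        change (#S : ℝ) + F z = 0
        rw [hF]; ring
      have h := (sum_eq_zero_iff_of_nonneg fun y _ => by linarith [htw1' y z]).1 hsum0 x hx
      linarith
  /- (D) the fourth moment `Σ_z F⁴ = 2¹² · #Q`, `#Q = Σ_a J(a)²`, `J = I`, `Σ_a J(a) = #S²` -/
  set P2 := S ×ˢ S with hP2
  set J : (Fin (6 + 6) → Bool) → ℕ := fun a => #(P2.filter fun q => bxor q.1 q.2 = a) with hJdef
  have hJI : ∀ a, J a = I a := by
    intro a
    simp only [J, I]
    refine card_nbij' (fun q => q.1) (fun x => (x, bxor x a)) (fun q hq => ?_) (fun x hx => ?_) (fun q hq => ?_) (fun x _ => rfl)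
    · rw [mem_coe, mem_filter, hP2, mem_product] at hq
      rw [mem_coe, mem_filter]
      refine ⟨hq.1.1, ?_⟩
      rw [← hq.2, bxor_bxor_cancel_left]; exact hq.1.2
    · rw [mem_coe, mem_filter] at hx
      rw [mem_coe, mem_filter, hP2, mem_product]
      exact ⟨⟨hx.1, hx.2⟩, bxor_bxor_cancel_left _ _⟩
    · rw [mem_coe, mem_filter] at hq
      obtain ⟨-, h⟩ := hq
      show (q.1, bxor q.1 a) = q
      rw [← h, bxor_bxor_cancel_left]
  have hJsum : ∑ a, (J a : ℝ) = #S * #S := by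
    have h := card_eq_sum_card_fiberwise (s := P2) (t := (univ : Finset (Fin (6 + 6) → Bool))) (f := fun q => bxor q.1 q.2)
      (fun q _ => mem_univ _)
    rw [hP2, card_product] at h
    have h' : ((#S * #S : ℕ) : ℝ) = ∑ a, (J a : ℝ) := by rw [h]; push_cast; rfl
    rw [← h']; push_cast; ring
  set Q := (P2 ×ˢ P2).filter (fun q => bxor q.1.1 q.1.2 = bxor q.2.1 q.2.2) with hQdef
  have hQ : (#Q : ℝ) = ∑ a, (J a : ℝ) ^ 2 := by
    have h := card_eq_sum_card_fiberwise (s := Q) (t := (univ : Finset (Fin (6 + 6) → Bool))) (f := fun q => bxor q.1.1 q.1.2)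
      (fun q _ => mem_univ _)
    rw [h]; push_cast
    refine sum_congr rfl fun a _ => ?_
    have e : Q.filter (fun q => bxor q.1.1 q.1.2 = a) = (P2.filter fun q => bxor q.1 q.2 = a) ×ˢ (P2.filter fun q => bxor q.1 q.2 = a) := by
      ext q
      simp only [hQdef, mem_filter, mem_product]
      constructor
      · rintro ⟨⟨hq, heq⟩, ha⟩; exact ⟨⟨hq.1, ha⟩, hq.2, by rw [← heq, ha]⟩
      · rintro ⟨⟨h1', ha1⟩, h2', ha2⟩; exact ⟨⟨⟨h1', h2'⟩, by rw [ha1, ha2]⟩, ha1⟩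
    rw [e, card_product]; push_cast; ring
  have hF2 : ∀ z, F z ^ 2 = ∑ q ∈ P2, twist (bxor q.1 q.2) z := by
    intro z
    rw [sq, hFdef, sum_mul_sum, hP2, sum_product]
    exact sum_congr rfl fun x _ => sum_congr rfl fun y _ => (twist_bxor_left x y z).symm
  have hF4 : ∑ z, F z ^ 4 = 4096 * (#Q : ℝ) := by
    have e1 : ∀ z, F z ^ 4 = ∑ q ∈ P2 ×ˢ P2, twist (bxor (bxor q.1.1 q.1.2) (bxor q.2.1 q.2.2)) z := by
      intro z
      rw [show F z ^ 4 = F z ^ 2 * F z ^ 2 by ring, hF2 z, sum_mul_sum, Finset.sum_product (s := P2) (t := P2)]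
      exact sum_congr rfl fun q _ => sum_congr rfl fun q' _ => (twist_bxor_left _ _ z).symm
    rw [sum_congr rfl fun z _ => e1 z, sum_comm]
    rw [sum_congr rfl fun q _ => Simon.sum_twist (bxor (bxor q.1.1 q.1.2) (bxor q.2.1 q.2.2))]
    rw [← sum_filter, sum_const, nsmul_eq_mul]
    have e2 : (P2 ×ˢ P2).filter (fun q => bxor (bxor q.1.1 q.1.2) (bxor q.2.1 q.2.2) = fun _ => false) = Q := by
      rw [hQdef]
      refine filter_congr fun q _ => ?_
      constructor
      · intro h
        have := congrArg (bxor (bxor q.1.1 q.1.2)) h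
        rw [bxor_bxor_cancel_left] at this
        rw [this]; exact (bxor_zeroVec _).symm
      · intro h; rw [h]; exact bxor_self _
    rw [e2, show (2 : ℝ) ^ (6 + 6) = 4096 by norm_num, mul_comm]
  /- (E) the two-sided squeeze on `Σ_z F⁴` -/
  have hIlin : ∀ a, (2 * (#S : ℝ) - 1280) * (I a : ℝ) - ((#S : ℝ) - 768) * ((#S : ℝ) - 512) ≤ (I a : ℝ) ^ 2 := by
    intro a; rcases hIvalR a with h | h | h <;> rw [h] <;> nlinarith
  have hIsum : ∑ a, (I a : ℝ) = #S * #S := by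
    have e : ∀ a, (I a : ℝ) = (J a : ℝ) := fun a => by rw [hJI a]
    rw [sum_congr rfl fun a _ => e a, hJsum]
  have hQJ : (#Q : ℝ) = ∑ a, (I a : ℝ) ^ 2 := by rw [hQ]; exact sum_congr rfl fun a _ => by rw [hJI a]
  have hI2 : (2 * (#S : ℝ) - 1280) * (#S * #S) - ((#S : ℝ) - 768) * ((#S : ℝ) - 512) * 4096 ≤ ∑ a, (I a : ℝ) ^ 2 := by
    have h := sum_le_sum fun a (_ : a ∈ (univ : Finset (Fin (6 + 6) → Bool))) => hIlin a
    rw [sum_sub_distrib, ← mul_sum, hIsum, sum_const, card_univ, Fintype.card_fun, Fintype.card_bool, Fintype.card_fin] at h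
    norm_num at h ⊢
    linarith
  have hF4pt : ∀ z, F z ^ 4 ≤ ((#S : ℝ) - 512) ^ 2 * F z ^ 2 +
      (if z = zeroVec then ((#S : ℝ) ^ 4 - ((#S : ℝ) - 512) ^ 2 * (#S : ℝ) ^ 2) else 0) := by
    intro z
    by_cases hz : z = zeroVec
    · rw [if_pos hz, hz, hF0]; nlinarith
    · rw [if_neg hz, add_zero]
      obtain ⟨k, hk, hFz⟩ := hFval z
      obtain ⟨hne1, hne2⟩ := hnoH z hz
      have hsq : F z ^ 2 ≤ ((#S : ℝ) - 512) ^ 2 := by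
        rcases hk with rfl | rfl | hk3 | rfl | ⟨hk1, hk2⟩
        · exfalso; apply hne1; rw [hFz]; norm_num
        · rw [hFz]; norm_num
        · have hk' : (k : ℝ) + 256 = #S := by exact_mod_cast hk3
          rw [hFz]; nlinarith
        · exfalso; apply hne2; rw [hFz]; ring
        · have hk1' : (384 : ℝ) ≤ k := by exact_mod_cast hk1
          have hk2' : (k : ℝ) + 384 ≤ #S := by exact_mod_cast hk2
          rw [hFz]
          nlinarith
      calc F z ^ 4 = F z ^ 2 * F z ^ 2 := by ring
        _ ≤ ((#S : ℝ) - 512) ^ 2 * F z ^ 2 := mul_le_mul_of_nonneg_right hsq (sq_nonneg _)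
  have hF4hi : ∑ z, F z ^ 4 ≤ ((#S : ℝ) - 512) ^ 2 * (4096 * #S) + ((#S : ℝ) ^ 4 - ((#S : ℝ) - 512) ^ 2 * (#S : ℝ) ^ 2) := by
    have h := sum_le_sum fun z (_ : z ∈ (univ : Finset (Fin (6 + 6) → Bool))) => hF4pt z
    rw [sum_add_distrib, ← mul_sum, hPars, sum_ite_eq' univ zeroVec, if_pos (mem_univ _)] at h
    exact h
  rw [hF4, hQJ] at hF4hi
  -- the three admissible weights
  have hw : #S = 784 ∨ #S = 800 ∨ #S = 816 := by omega
  rcases hw with h | h | h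
  · have hW : (#S : ℝ) = 784 := by exact_mod_cast h
    rw [hW] at hI2 hF4hi; norm_num at hI2 hF4hi; linarith
  · have hW : (#S : ℝ) = 800 := by exact_mod_cast h
    rw [hW] at hI2 hF4hi; norm_num at hI2 hF4hi; linarith
  · have hW : (#S : ℝ) = 816 := by exact_mod_cast h
    rw [hW] at hI2 hF4hi; norm_num at hI2 hF4hi; linarith

end Summit.QuantumAdvantage.QuantumAdvantage.Theorems.CubicForrelation.NearExactIsExact

end
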